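import Summits.BirchSwinnertonDyer.Rank1Residual.X4.OldPairOfIharaSurj
import HarnessLib

/-!
# Two-copy Ihara surjectivity at one ideal FROM the three-level statement plus a support annihilator (cell `b2b-bsdres`, seat additive-p4, line V48)

HONEST FRAMING (verbatim, cell `b2b-bsdres`): the goal of the cell is to DELETE the COMBINATION-SHAPED
residual classes for ALL analytic-rank `≤ 1` curves over `ℚ` — "full BSD formula for every rank `≤ 1`
curve in class `C`" assembled STRICTLY from published theorems — so that the rank-`≤ 1` remainder
becomes exactly the CONSTRUCTION-SHAPED classes, which are TYPED (missing-input Props), NOT attempted;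
this is not "finishing BSD". This file: ONE TOOL theorem (pure algebra), 0 defs, 0 facts, nothing
booked; X4 CONSTRUCTION-SHAPED. It records in the kernel WHY the hypothesis `hS` of
`X4/OldPairOfIharaSurj` / `X4/AdditiveOldShape` (two-copy surjectivity of `(α_*, β_*)` at ONE ideal
`𝔫`, `ℓ ∣ M` allowed) is the right reading of the literature for the NL residue: it is the
COMPOSITION of (i) the THREE-LEVEL Ihara statement at `𝔫` (the hypothesis `hI3` of
`X4/OldPairOfNewVanishingSq`: some `s ∉ 𝔫` lifts every pair `(x, y)` of level-`M` cycles with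
`β′_* x = α′_* y` to a level-`Mℓ` cycle over `(s x, s y)`; Wiles 1995 Lemma 2.5 / Darmon–Diamond–Taylor
Lemma 4.28 (b) + 4.30) with (ii) a SUPPORT ANNIHILATOR: some `s₁ ∉ 𝔫` kills both push-forwards
`H₁(X₀(M), ℤ) → H₁(X₀(M′), ℤ)` (`𝔫` is not in the support of the level-`M′` homology — for the maximal
ideal of a residual representation RAMIFIED at `ℓ ∤ M′`, Carayol–Livné: the prime-to-`p` conductor
of `ρ̄` divides the level of every form carrying it; cf. Diamond–Ribet 1997, proof of Lemma 4.6, case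
`m_p = 1`: "using also that `𝔪′` is not in the support of `H₁(X₀(N_Σ/p), ℤ_ℓ)`").

## What is proved

`surjAt_of_iharaThree_of_annihilator`: for a prime ideal `𝔫 ⊂ 𝕋̃ = ℤ[T_r : r ∤ Mℓ]`, `s, s₁ ∉ 𝔫`
as in (i), (ii) ⟹ `t = s s₁ ∉ 𝔫` multiplies `H₁(X₀(M), ℤ)²` into `im(α_*, β_*)` — i.e. the pair
`(s₁ x, s₁ y)` satisfies the `K`-condition trivially (`0 = 0`), and (i) lifts it. No arithmetic.

## References

* H. Darmon, F. Diamond, R. Taylor, *Fermat's Last Theorem* (1995), Lemma 4.28, 4.30, §4.5 p. 137. [cite: DarmonDiamondTaylor1995, Lemma 4.28 (a), Lemma 4.30 (b), §4.5 pp. 135–137]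
* F. Diamond, K. Ribet, in Cornell–Silverman–Stevens (1997), §4.4 Lemma 4.6. [cite: DiamondRibet1997, §4.4 Lemma 4.6]
* H. Carayol, Duke Math. J. 59 (1989). [cite: Carayol1989, Théorème 1]
-/

noncomputable section

open scoped MatrixGroups ModularForm

open CongruenceSubgroup

open Literature.NumberTheory.EllipticCurves Literature.NumberTheory.EllipticCurves.ModularForms

namespace Summit.BirchSwinnertonDyer.Rank1Residual.LevelLowering

variable {M' M : ℕ} [NeZero M'] [NeZero M] {ℓ : ℕ} [Fact ℓ.Prime]

/-- **TWO-COPY SURJECTIVITY AT `𝔫` = THREE-LEVEL IHARA AT `𝔫` ∘ SUPPORT ANNIHILATOR.** Let `𝔫` be a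
prime ideal of `𝕋̃ = ℤ[T_r : r ∤ Mℓ]` (level-`M` operators). (i) `hI3`: `s ∉ 𝔫` and every pair of
cycles `x, y ∈ H₁(X₀(M), ℤ)` with `β′_* x = α′_* y` (`α′ = [1], β′ = [ℓ] : S₂(Γ₀(M′)) → S₂(Γ₀(M))`)
lifts to `z ∈ H₁(X₀(Mℓ), ℤ)` with `α_* z = s x`, `β_* z = s y`; (ii) `hann`: `s₁ ∉ 𝔫` with
`β′_*(s₁ x) = 0 = α′_*(s₁ x)` for every cycle `x` (the level-`M′` homology has no `𝔫`-part). Then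
`t = s s₁ ∉ 𝔫` and every `(x, y)` lifts to a cycle over `(t x, t y)`: the hypothesis `hS` of
`exists_oldPair_of_apply_eq_zero_of_surjAt` at `𝔫`. [cite: DiamondRibet1997, §4.4 Lemma 4.6]
[cite: DarmonDiamondTaylor1995, Lemma 4.28 (a), Lemma 4.30 (b), §4.5 pp. 135–137] -/
theorem surjAt_of_iharaThree_of_annihilator (𝔫 : Ideal (HeckeRing0.primeTo M 2 (M * ℓ)))
    (h𝔫 : 𝔫.IsPrime) {s : HeckeRing0.primeTo M 2 (M * ℓ)} (hs : s ∉ 𝔫)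
    (hI3 : ∀ x ∈ periodHomology M, ∀ y ∈ periodHomology M,
      (degeneracyMap0 M' M ℓ 2).dualMap x = (degeneracyMap0 M' M 1 2).dualMap y →
      ∃ z ∈ periodHomology (M * ℓ),
        (degeneracyMap0 M (M * ℓ) 1 2).dualMap z = (s : HeckeRing0 M 2) • x ∧
        (degeneracyMap0 M (M * ℓ) ℓ 2).dualMap z = (s : HeckeRing0 M 2) • y)
    {s₁ : HeckeRing0.primeTo M 2 (M * ℓ)} (hs₁ : s₁ ∉ 𝔫)
    (hann : ∀ x ∈ periodHomology M,
      (degeneracyMap0 M' M ℓ 2).dualMap ((s₁ : HeckeRing0 M 2) • x) = 0 ∧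
      (degeneracyMap0 M' M 1 2).dualMap ((s₁ : HeckeRing0 M 2) • x) = 0) :
    ∃ t : HeckeRing0.primeTo M 2 (M * ℓ), t ∉ 𝔫 ∧
      ∀ x ∈ periodHomology M, ∀ y ∈ periodHomology M, ∃ z ∈ periodHomology (M * ℓ),
        (degeneracyMap0 M (M * ℓ) 1 2).dualMap z = (t : HeckeRing0 M 2) • x ∧
        (degeneracyMap0 M (M * ℓ) ℓ 2).dualMap z = (t : HeckeRing0 M 2) • y := by
  refine ⟨s * s₁, fun h ↦ (h𝔫.mem_or_mem h).elim hs hs₁, fun x hx y hy ↦ ?_⟩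
  have hx₁ : (s₁ : HeckeRing0 M 2) • x ∈ periodHomology M := HeckeRing0.smul_mem_periodHomology M _ hx
  have hy₁ : (s₁ : HeckeRing0 M 2) • y ∈ periodHomology M := HeckeRing0.smul_mem_periodHomology M _ hy
  have hK : (degeneracyMap0 M' M ℓ 2).dualMap ((s₁ : HeckeRing0 M 2) • x) =
      (degeneracyMap0 M' M 1 2).dualMap ((s₁ : HeckeRing0 M 2) • y) := by
    rw [(hann x hx).1, (hann y hy).2]
  obtain ⟨z, hz, hα, hβ⟩ := hI3 _ hx₁ _ hy₁ hK
  refine ⟨z, hz, ?_, ?_⟩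
  · rw [hα, Subalgebra.coe_mul, mul_smul]
  · rw [hβ, Subalgebra.coe_mul, mul_smul]

end Summit.BirchSwinnertonDyer.Rank1Residual.LevelLowering

end
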